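import Mathlib
import Summits.MatrixMultiplication.Statement
import Summits.MatrixMultiplication.MatrixMultiplication.Theorems.GraphEquationsGenerators
import Summits.MatrixMultiplication.MatrixMultiplication.Theorems.GraphEquationsPurification
import Summits.MatrixMultiplication.MatrixMultiplication.Theorems.GraphEquationsFiniteOrder

/-!
# GraphEquations — the MEMBERSHIP-EXPONENT hand: NEC, and the bridge to `MultiplicityReduction`
# (M19c, decomp-mm-lens-5 g32)

(supports `MultiplicityReduction`, stmt-MatrixMultiplication-27806.)

Module `GraphEquationsFiniteOrder` (M19b) introduced the membership-exponent currency: correct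
systems of cost `O(n^β)` whose test ideal `J_E` contains `f_q^e` for every generator `f_q` of
`𝕀(W_n)`, ONE `e` for all `n`.  Here:

* `generatorSystem_generator_mem_span` / `exists_correct_generator_mem_of_omega_lt` — the generator
  systems of the tree (`GraphEquationsGenerators`: a fast circuit for `AB`, tests `c_q − (AB)_q`) have
  `f_q ∈ J_E` on the nose, so above `ω` the currency is inhabited with `e = 1`;
* `nullExpReduction_of_matrixMultiplication` — **NEC**: `ω = 2` implies the asymptotic-regime
  statement NER ("membership-exponent reduction": every admissible exponent `β` admits, at every
  `β' > β`, cheap correct systems with a UNIFORM membership exponent), with `e = 1`;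
* `isolationOrderReduction_of_nullExpReduction` — NER implies the `purisplit` hand OR′
  (uniform ideal-isolation order), by M19b;
* `multiplicityReduction_of_nullExpReduction` — **the bridge**: NER together with the finite-range
  family BOP′ (`∀ K`, bounded-order purification) implies the crux `MultiplicityReduction`
  (Theorems-side statement `GraphEquations.MultiplicityReduction`, definitionally the route decl).

So NER is a certified alternative second hand for the line OR′ ∧ BOP′ ⇒ `MultiplicityReduction`:
NEC, at least as strong as OR′, and phrased as pure IDEAL MEMBERSHIP (no local analysis, no base
point) — the form in which effective-Nullstellensatz degree bounds ([Kollar1988]) and membership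
complexity bear on it.  All statements are spelled out over existing declarations (no new `def`).

No `sorry`.
-/

set_option linter.dupNamespace false

noncomputable section

open scoped BigOperators

namespace Summit.MatrixMultiplication.MatrixMultiplication.Theorems.GraphEquations

open MvPolynomial
open Literature.Computability.AlgebraicComplexity
open Literature.Computability.AlgebraicComplexity.ArithCircuit

variable {n : ℕ}

/-! ## Generator systems have `f_q ∈ J_E` -/

section generators

variable (P : ArithCircuit ℂ (MatMulVars n)) (idx : Fin n × Fin n → ℕ)

/-- The renamed generic product entry is the bilinear part of the generator. -/
theorem rename_genericMatMulEntry (q : Fin n × Fin n) :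
    MvPolynomial.rename (Sum.inl : MatMulVars n → GraphVars n) (genericMatMulEntry ℂ n q.1 q.2) =
      ∑ k : Fin n, X (Sum.inl (Sum.inl (q.1, k))) * X (Sum.inl (Sum.inr (k, q.2))) := by
  simp [genericMatMulEntry, map_sum]

/-- The test of the generator system indexed by `q` IS the generator `f_q`. -/
theorem generatorSystem_testPoly_eq_generator (hidx : ∀ p, idx p < P.size)
    (hval : ∀ p : Fin n × Fin n,
      (gateValues P.gates)[idx p]? = some (genericMatMulEntry ℂ n p.1 p.2))
    (q : Fin n × Fin n) :
    (generatorSystem P idx).testPoly (P.size + ((finProdFinEquiv q : Fin (n * n)) : ℕ)) =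
      generator n q := by
  rw [generatorSystem_testPoly P idx hidx hval, Equiv.symm_apply_apply, rename_genericMatMulEntry]
  rfl

/-- Every generator lies in the test ideal of a generator system (membership exponent `1`). -/
theorem generatorSystem_generator_mem_span (hidx : ∀ p, idx p < P.size)
    (hval : ∀ p : Fin n × Fin n,
      (gateValues P.gates)[idx p]? = some (genericMatMulEntry ℂ n p.1 p.2))
    (q : Fin n × Fin n) :
    generator n q ∈ Ideal.span (Set.range fun o : Fin (generatorSystem P idx).tests.length =>
      (generatorSystem P idx).testPoly ((generatorSystem P idx).tests.get o)) := by
  have hlen : ((finProdFinEquiv q : Fin (n * n)) : ℕ) < (generatorSystem P idx).tests.length := by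
    rw [generatorSystem_tests_length]; exact (finProdFinEquiv q).2
  refine Ideal.subset_span ⟨⟨(finProdFinEquiv q : Fin (n * n)), hlen⟩, ?_⟩
  have hget : (generatorSystem P idx).tests.get ⟨(finProdFinEquiv q : Fin (n * n)), hlen⟩ =
      P.size + ((finProdFinEquiv q : Fin (n * n)) : ℕ) := by
    simp [generatorSystem]
  simp only [hget]
  exact generatorSystem_testPoly_eq_generator P idx hidx hval q

end generators

/-- Above `ω` there are correct systems of cost `O(n^β)` whose test ideal contains every generator
`f_q` itself (membership exponent `e = 1`). -/
theorem exists_correct_generator_mem_of_omega_lt {β : ℝ} (hβ : omega ℂ < β) :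
    ∃ c : ℝ, ∀ n : ℕ, 1 ≤ n → ∃ E : EqSystem n, E.Correct ∧
      (∀ q : Fin n × Fin n, generator n q ^ 1 ∈
        Ideal.span (Set.range fun o : Fin E.tests.length => E.testPoly (E.tests.get o))) ∧
      (E.cost : ℝ) ≤ c * (n : ℝ) ^ β := by
  obtain ⟨C, hC⟩ := BurgisserClausenShokrollahi1997_prop151_holds ℂ (β - omega ℂ) (sub_pos.2 hβ)
  refine ⟨C + 1, fun n hn => ?_⟩
  obtain ⟨P, hP2, hPc, hPs⟩ := hC n hn
  have hex : ∀ p : Fin n × Fin n, ∃ j,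
      (gateValues P.gates)[j]? = some (genericMatMulEntry ℂ n p.1 p.2) :=
    fun p => List.mem_iff_getElem?.1 (hPc p.1 p.2)
  choose idx hidx using hex
  have hlt : ∀ p, idx p < P.size := fun p => by
    have := (List.getElem?_eq_some_iff.1 (hidx p)).1
    simpa [ArithCircuit.size] using this
  refine ⟨generatorSystem P idx, ⟨generatorSystem_isFanInTwo P idx hP2,
    generatorSystem_zeroSet P idx hlt hidx⟩, fun q => ?_, ?_⟩
  · rw [pow_one]; exact generatorSystem_generator_mem_span P idx hlt hidx q
  rw [generatorSystem_cost]
  have hn1 : (1 : ℝ) ≤ n := by exact_mod_cast hn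
  have hω2 : (2 : ℝ) ≤ β := (omega_two_le ℂ).trans hβ.le
  have hsq : (n : ℝ) * n ≤ (n : ℝ) ^ β := by
    have h := Real.rpow_le_rpow_of_exponent_le hn1 (show ((2 : ℕ) : ℝ) ≤ β by exact_mod_cast hω2)
    rw [Real.rpow_natCast, sq] at h
    exact h
  have hβeq : omega ℂ + (β - omega ℂ) = β := by ring
  rw [hβeq] at hPs
  push_cast
  linarith

/-! ## NER: NEC, ⇒ OR′, and the bridge to the crux -/

/-- **NEC for the membership-exponent hand.**  `ω = 2` ⇒ NER: for every admissible `β ≥ 2` and every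
`β' > β` there are an exponent `e ≥ 1` and correct systems of cost `O(n^{β'})` with `f_q^e ∈ J_E`
for all `q` and all `n` (indeed `e = 1`). -/
theorem nullExpReduction_of_matrixMultiplication (hS : _root_.MatrixMultiplication) :
    ∀ β : ℝ, 2 ≤ β → EqAdmissible β → ∀ β' : ℝ, β < β' →
      ∃ e : ℕ, 1 ≤ e ∧ ∃ c : ℝ, ∀ n : ℕ, 1 ≤ n → ∃ E : EqSystem n, E.Correct ∧
        (∀ q : Fin n × Fin n, generator n q ^ e ∈
          Ideal.span (Set.range fun o : Fin E.tests.length => E.testPoly (E.tests.get o))) ∧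
        (E.cost : ℝ) ≤ c * (n : ℝ) ^ β' := by
  intro β hβ _ β' hβ'
  have h : omega ℂ = 2 := hS
  exact ⟨1, le_rfl, exists_correct_generator_mem_of_omega_lt (by rw [h]; linarith)⟩

/-- **NER ⇒ OR′** (uniform membership exponent ⇒ uniform ideal-isolation order), by
`eqAdmissibleIdealIso_of_generator_pow_mem`. -/
theorem isolationOrderReduction_of_nullExpReduction
    (hNER : ∀ β : ℝ, 2 ≤ β → EqAdmissible β → ∀ β' : ℝ, β < β' →
      ∃ e : ℕ, 1 ≤ e ∧ ∃ c : ℝ, ∀ n : ℕ, 1 ≤ n → ∃ E : EqSystem n, E.Correct ∧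
        (∀ q : Fin n × Fin n, generator n q ^ e ∈
          Ideal.span (Set.range fun o : Fin E.tests.length => E.testPoly (E.tests.get o))) ∧
        (E.cost : ℝ) ≤ c * (n : ℝ) ^ β') :
    ∀ β : ℝ, 2 ≤ β → EqAdmissible β → ∀ β' : ℝ, β < β' → ∃ K : ℕ, EqAdmissibleIdealIso β' K := by
  intro β hβ hE β' hβ'
  obtain ⟨e, he, h⟩ := hNER β hβ hE β' hβ'
  exact ⟨e, eqAdmissibleIdealIso_of_generator_pow_mem he h⟩

/-- **THE BRIDGE: NER ∧ BOP′ ⇒ `MultiplicityReduction`.**  The asymptotic-regime statement NER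
(uniform membership exponent along cheaper-than-any-`β' > β` correct families) together with the
finite-range family BOP′ (for every order `K`: ideal isolation of order `K` along a cost-`O(n^β)`
family ⇒ pure isolated systems at every `β' > β`; rungs `K = 1, 2` are theorems of the tree) gives
the crux. -/
theorem multiplicityReduction_of_nullExpReduction
    (hNER : ∀ β : ℝ, 2 ≤ β → EqAdmissible β → ∀ β' : ℝ, β < β' →
      ∃ e : ℕ, 1 ≤ e ∧ ∃ c : ℝ, ∀ n : ℕ, 1 ≤ n → ∃ E : EqSystem n, E.Correct ∧
        (∀ q : Fin n × Fin n, generator n q ^ e ∈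
          Ideal.span (Set.range fun o : Fin E.tests.length => E.testPoly (E.tests.get o))) ∧
        (E.cost : ℝ) ≤ c * (n : ℝ) ^ β')
    (hBOP : ∀ (K : ℕ) (β : ℝ), 2 ≤ β → EqAdmissibleIdealIso β K →
      ∀ β' : ℝ, β < β' → EqAdmissiblePure β') :
    MultiplicityReduction := by
  have hP : Purification := by
    intro β hβ hE β' hβ'
    obtain ⟨K, hK⟩ :=
      isolationOrderReduction_of_nullExpReduction hNER β hβ hE ((β + β') / 2) (by linarith)
    exact hBOP K ((β + β') / 2) (by linarith) hK β' (by linarith)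
  exact hP.multiplicityReduction

/-- **Unconditional instance of the bridge at `e ≤ 2`** (rung `K = 2` of BOP′ is a theorem): if every
admissible exponent admits, at every `β' > β`, cheap correct systems whose test ideals contain the
SQUARES `f_q²`, then `MultiplicityReduction` holds. -/
theorem multiplicityReduction_of_sqMemReduction
    (hSQ : ∀ β : ℝ, 2 ≤ β → EqAdmissible β → ∀ β' : ℝ, β < β' →
      ∃ c : ℝ, ∀ n : ℕ, 1 ≤ n → ∃ E : EqSystem n, E.Correct ∧
        (∀ q : Fin n × Fin n, generator n q ^ 2 ∈
          Ideal.span (Set.range fun o : Fin E.tests.length => E.testPoly (E.tests.get o))) ∧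
        (E.cost : ℝ) ≤ c * (n : ℝ) ^ β') :
    MultiplicityReduction := by
  have hP : Purification := by
    intro β hβ hE β' hβ'
    have hiso : EqAdmissibleIdealIso ((β + β') / 2) 2 :=
      eqAdmissibleIdealIso_of_generator_pow_mem (by norm_num) (hSQ β hβ hE ((β + β') / 2) (by linarith))
    exact boundedOrderPurification_two ((β + β') / 2) (by linarith) hiso β' (by linarith)
  exact hP.multiplicityReduction

end Summit.MatrixMultiplication.MatrixMultiplication.Theorems.GraphEquations

end
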